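import Mathlib

/-!
# The degree window for generically finite maps of surfaces — algebraic core

Solo-blind ideation seat `solo-HodgeConjecture-blind` (session s42), companion to the paper note
`work/s42/dpc-e1.md` §3 (THEOREM DW).  No literature is cited: the statement is five lines from the
Hodge index theorem and is recorded here as an exact, kernel-checked window.

## The geometric statement (paper)

Let `π : Y → X` be a generically finite morphism of degree `d` between smooth projective surfaces and
`F₁, F₂ ∈ NS(Y)` with `F₁² = F₂² = 0`, `F₁·F₂ = 1` (e.g. the two fibre classes of a blown-up product
of curves).  Put `D := π_* F₁`, `D' := π_* F₂`, `a := D²`, `b := D'²`, `c := D·D'` and assume `a > 0`.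
Writing `π^* D = c F₁ + a F₂ + φ`, `π^* D' = b F₁ + c F₂ + φ'` with `φ, φ'` orthogonal to `F₁, F₂`,
the projection formula gives
`d a = 2 a c + φ²`, `d b = 2 b c + φ'²`, `d c = c² + a b + φ·φ'`,
the Hodge index theorem on `Y` says that the orthogonal complement of the hyperbolic plane `⟨F₁,F₂⟩`
is negative definite (so `φ² ≤ 0`, `φ'² ≤ 0`, `(φ·φ')² ≤ φ² φ'²`), and the Hodge index theorem on `X`
gives `a b ≤ c²`.  CONCLUSION (DW): `d ≤ 2c` and `(d - c)² ≤ a b`, i.e.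
`D·D' - √(D² D'²) ≤ deg π ≤ D·D' + √(D² D'²)`; sharp for `ℙ¹ × ℙ¹ → ℙ²` by forms of bidegree `(m,n)`.

## What is certified here

* `cs_identity` — the polynomial identity turning the Cauchy–Schwarz form into the product form
  `(ab - c²)(ab - (d-c)²)`;
* `degree_window` — the real-algebra core: from `0 < a`, `0 < d`, `ab ≤ c²`, `da - 2ac ≤ 0` and the
  Cauchy–Schwarz inequality `(dc - c² - ab)² ≤ (da - 2ac)(db - 2bc)` conclude `d ≤ 2c ∧ (d-c)² ≤ ab`;
* `degree_window_inner` — the same with the negative definite complement modelled as a real inner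
  product space (`φ² = -‖φ‖²`), Cauchy–Schwarz supplied by Mathlib;
* `sharp_bidegree` — the equality case `d = 2mn, a = n², b = m², c = mn`.

The Hodge index theorem itself and the projection formula are the (uncertified) geometric inputs.
-/

namespace Summit.HodgeConjecture.HodgeConjecture.Theorems.DegreeWindow

/-- The Cauchy–Schwarz form minus the rescaled norm product is the product
`(ab - c²)(ab - (d - c)²)`; this is the whole computation behind the degree window. -/
theorem cs_identity (a b c d : ℝ) :
    (d * c - c ^ 2 - a * b) ^ 2 - a * b * (d - 2 * c) ^ 2
      = (a * b - c ^ 2) * (a * b - (d - c) ^ 2) := by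
  ring

/-- The norm product `(da - 2ac)(db - 2bc)` equals `ab (d - 2c)²`. -/
theorem norm_product (a b c d : ℝ) :
    (d * a - 2 * a * c) * (d * b - 2 * b * c) = a * b * (d - 2 * c) ^ 2 := by
  ring

/-- **Degree window, algebraic core.**  `a, b, c` are the intersection numbers `D², D'², D·D'` of the
push-forwards of two classes with `F₁² = F₂² = 0`, `F₁F₂ = 1` under a generically finite map of
degree `d`; `hX` is Hodge index on the target, `hY` is `φ² ≤ 0` and `hCS` is Cauchy–Schwarz in the
negative definite complement of `⟨F₁, F₂⟩` on the source.  Conclusion: `d ≤ 2c` and `(d-c)² ≤ ab`. -/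
theorem degree_window (a b c d : ℝ) (ha : 0 < a) (hd : 0 < d) (hX : a * b ≤ c ^ 2)
    (hY : d * a - 2 * a * c ≤ 0)
    (hCS : (d * c - c ^ 2 - a * b) ^ 2 ≤ (d * a - 2 * a * c) * (d * b - 2 * b * c)) :
    d ≤ 2 * c ∧ (d - c) ^ 2 ≤ a * b := by
  have h1 : d ≤ 2 * c := by nlinarith
  refine ⟨h1, ?_⟩
  have key : (a * b - c ^ 2) * (a * b - (d - c) ^ 2) ≤ 0 := by
    rw [← cs_identity, norm_product a b c d] at *
    linarith [hCS]
  rcases lt_or_eq_of_le hX with hlt | heq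
  · by_contra hcon
    push Not at hcon
    have hpos : 0 < (a * b - c ^ 2) * (a * b - (d - c) ^ 2) :=
      mul_pos_of_neg_of_neg (by linarith) (by linarith)
    linarith
  · have h2 : 0 ≤ d * (2 * c - d) := mul_nonneg hd.le (by linarith)
    nlinarith [h2, heq]

/-- **Degree window, inner-product form.**  The negative definite lattice `⟨F₁,F₂⟩^⊥ ⊗ ℝ` is modelled
as a real inner product space with `φ² = -‖φ‖²`; the three hypotheses `h₁, h₂, h₃` are the projection
formula identities `(π^*D)² = d D²`, `(π^*D')² = d D'²`, `π^*D · π^*D' = d D·D'`. -/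
theorem degree_window_inner {W : Type*} [NormedAddCommGroup W] [InnerProductSpace ℝ W]
    (φ φ' : W) (a b c d : ℝ) (ha : 0 < a) (hd : 0 < d) (hX : a * b ≤ c ^ 2)
    (h₁ : d * a = 2 * a * c - ‖φ‖ ^ 2) (h₂ : d * b = 2 * b * c - ‖φ'‖ ^ 2)
    (h₃ : d * c = c ^ 2 + a * b - inner ℝ φ φ') :
    d ≤ 2 * c ∧ (d - c) ^ 2 ≤ a * b := by
  have hcs : |inner ℝ φ φ'| ≤ ‖φ‖ * ‖φ'‖ := abs_real_inner_le_norm φ φ'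
  have hsq : (inner ℝ φ φ') ^ 2 ≤ (‖φ‖ * ‖φ'‖) ^ 2 := by
    have h0 : 0 ≤ |inner ℝ φ φ'| := abs_nonneg _
    calc (inner ℝ φ φ') ^ 2 = |inner ℝ φ φ'| ^ 2 := (sq_abs _).symm
      _ ≤ (‖φ‖ * ‖φ'‖) ^ 2 := pow_le_pow_left₀ h0 hcs 2
  refine degree_window a b c d ha hd hX ?_ ?_
  · nlinarith [norm_nonneg φ, h₁]
  · have e1 : d * a - 2 * a * c = -‖φ‖ ^ 2 := by linarith
    have e2 : d * b - 2 * b * c = -‖φ'‖ ^ 2 := by linarith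
    have e3 : d * c - c ^ 2 - a * b = -inner ℝ φ φ' := by linarith
    rw [e1, e2, e3]
    nlinarith [hsq]

/-- Sharpness: `ℙ¹ × ℙ¹ → ℙ²` by three general forms of bidegree `(m, n)` has `d = 2mn`,
`a = n²`, `b = m²`, `c = mn`, and `(d - c)² = ab` exactly (and `d = 2c`). -/
theorem sharp_bidegree (m n : ℝ) :
    (2 * m * n - m * n) ^ 2 = n ^ 2 * m ^ 2 ∧ 2 * m * n = 2 * (m * n) := by
  constructor <;> ring

/-- The Kummer control: for `C₁ × C₂ → A ⇢ Km(A)` one has `d = c`, so `(d - c)² = 0 ≤ ab` with room;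
recorded as the trivial arithmetic fact it is (the window cannot exclude such dominations). -/
theorem kummer_control (a b c : ℝ) (ha : 0 ≤ a) (hb : 0 ≤ b) :
    (c - c) ^ 2 ≤ a * b := by
  simp [mul_nonneg ha hb]

/-- Integer form of the window for lattice data (the form used on the T₈ face, where
`a, b ≥ 14`): if `a b ≤ c²`, `0 < a`, `0 < d`, and the source-side Hodge-index data hold,
then `d ≤ 2c` and `(d - c)² ≤ a b`. -/
theorem degree_window_int (a b c d : ℤ) (ha : 0 < a) (hd : 0 < d) (hX : a * b ≤ c ^ 2)
    (hY : d * a - 2 * a * c ≤ 0)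
    (hCS : (d * c - c ^ 2 - a * b) ^ 2 ≤ (d * a - 2 * a * c) * (d * b - 2 * b * c)) :
    d ≤ 2 * c ∧ (d - c) ^ 2 ≤ a * b := by
  have h := degree_window (a : ℝ) b c d (by exact_mod_cast ha) (by exact_mod_cast hd)
    (by exact_mod_cast hX) (by exact_mod_cast hY) (by exact_mod_cast hCS)
  exact ⟨by exact_mod_cast h.1, by exact_mod_cast h.2⟩

end Summit.HodgeConjecture.HodgeConjecture.Theorems.DegreeWindow
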